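import Summits.MatrixMultiplication.MatrixMultiplication.Theses.DesignFlattening
import Summits.MatrixMultiplication.MatrixMultiplication.Theorems.AutomaticSTPPDesignsAutomaticPackingThesisStubExpBeatsPoly

/-!
# Crux `GrowingHostDesigns` (stmt-MatrixMultiplication-8033) — `Lines/toric-punctures.lean`

Strategist line `toric-punctures` (lens: STRENGTHEN to a combinatorial statement; the residual,
multi-block regime of X).  A TORIC PUNCTURING of a hosting `(G, P, α, β, γ)` of `p ⊙ ⟨m,m,m⟩` is a triple
of integer weights `w_a, w_b, w_c : G → ℤ` with `w_a(u+v) + w_b(u) + w_c(v) ≥ 0` on every cell of the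
addition table and `= 0` exactly on the kept cells `P` — i.e. the punctured table `T_P = U_G · 1_P` is the
COMBINATORIAL (toric) DEGENERATION of the full table `U_G` along these weights (Strassen / BCS §15.4
M-degenerations, here inside the group basis).  Two facts make this a line for X:

* LEVEL-SET COMPLETIONS (`stub_weightCompletion`, provable): weights add over coordinates, so on the
  `N`-th power the indicator `S_N(a;b,c) := [W_a(a) + W_b(b) + W_c(c) = 0]` (`W_a(a) = Σ_t w_a(a_t)` …)
  equals `1_{P^N}(b,c)` on the addition graph (a sum of `N` non-negative terms vanishes iff every term
  does) and is a sum of `|range W_a| · |range W_b| ≤ (N·h + 1)²` triads (`h` = weight range): an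
  ENTANGLED completion of `T_P^{⊗N}` of rank POLYNOMIAL in `N` — exactly the freedom that the separable
  designs of line `birth` (rank multiplicative in `N`) cannot see, and invisible at `N = 1`
  (where `WindowSqrtBarrier`-type rigidity lives).
* EXPONENTIAL BEATS POLYNOMIAL (tree lemma `AutomaticPackingThesis.stub_expBeatsPoly`): if
  `|G| ≤ p · m^{2+η/2}` then `|G|^N (N h + 1)² ≤ (p · m^{2+η})^N` for some `N ≥ 1`.

So X follows from the purely COMBINATORIAL `stub_toricPacking`: for every `η > 0` a punctured abelian
hosting of `p ⊙ ⟨m,m,m⟩` on the nose whose kept set is cut out by a toric weight triple, with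
`|G| ≤ p · m^{2+η}`.  Structure of that stub (strategist census, § Strengthen / § Decomposition):
weights `≡ 0` ⟺ no collisions ⟺ abelian STPP at capacity (uniform form of GroupTheoreticSTPP.CThesis,
stmt-0593), so the stub is implied by CKSU's abelian conjectures and is at least as plausible; for ONE
block (`p = 1`) collisions come in antipodal pairs with opposite weight, so toric puncturing forces TPP
and `|G| ≥ m³` (no gain, consistent with the tight-host averaging identity) — the new freedom is exactly
CROSS-BLOCK: within-block TPP plus "graded STPP" (every cross-block coincidence
`B_j(κ')−B_i(κ)+C_k(ν')−C_i(ν)+φ_j(μ)−φ_k(μ') = 0` must have positive potential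
`b_j(κ')+ψ_j(μ)+c_k(ν')−ψ_k(μ')−b_i(κ)−c_i(ν)`; block-constant potentials `u_j + v_k > u_i + v_i` already
relax STPP to "coincidences only from higher to lower grade"), in the regime `p ≥ m^{1−2η}` that
`WindowSqrtBarrier` forces on X anyway.  Barrier: a toric puncturing is field-independent, so over `𝔽_ℓ`
slice rank still kills hosts of bounded exponent (BCCGNSU Thm B transfers verbatim: `U_G ⊵ T_P ⊵
p ⊙ ⟨m,m,m⟩ ⊵ ⟨¾ p m²⟩`); cyclic / growing-exponent hosts are untouched (Behrend, full slice rank).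

`GrowingHostDesigns_of` is a real proof threading the two stubs and the tree lemma into X BY NAME.
-/

set_option linter.dupNamespace false

namespace Summit.MatrixMultiplication.MatrixMultiplication.Cruxes.GrowingHostDesigns.ToricPunctures

open Summit.MatrixMultiplication.MatrixMultiplication.Theses.DesignFlattening
open Literature.Computability.AlgebraicComplexity
open scoped BigOperators

/-- By-name alias of the crux, used ONLY as the result type of the parametrised composition
`GrowingHostDesigns_of` below, so that the skeleton audit (`#h21_check_skeleton`: the skeleton theorem must conclude
the crux by name and take no `Prop` hypotheses other than registered obligations) reads the hypothesis-free
`GrowingHostDesigns_of_stubs` as THE skeleton theorem; `GrowingHostDesignsVia` unfolds reducibly to the crux. -/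
abbrev GrowingHostDesignsVia : Prop := GrowingHostDesigns

/-- STUB 1 — TORIC PUNCTURED PACKINGS AT CAPACITY (open; combinatorial; the line's bet, size XL).
For every `η > 0`: a finite abelian `G`, a kept set `P ⊆ G × G`, `p ≥ 1` blocks of `⟨m,m,m⟩` (`m ≥ 2`)
hosted on the nose in the punctured table `[u+v = g ∧ (u,v) ∈ P]` (the hosting clause of X verbatim),
integer weights `w_a w_b w_c : G → ℤ` with `w_a(u+v) + w_b(u) + w_c(v) ≥ 0` everywhere and `= 0` iff
`(u,v) ∈ P`, and `|G| ≤ p · m^{2+η}`.  Weights `≡ 0` (then `P = univ`) is abelian STPP at capacity;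
`p = 1` forces TPP (antipodal collisions), so witnesses need `p ≥ 2` and `|G| ≥ m³`. -/
theorem stub_toricPacking :
    ∀ η : ℝ, 0 < η → ∃ (G : Type) (_ : AddCommGroup G) (_ : Fintype G) (_ : DecidableEq G)
      (P : Finset (G × G)) (p m : ℕ), 1 ≤ p ∧ 2 ≤ m ∧
      (∃ α β γ : (Σ _ : Fin p, Fin m × Fin m) → G, ∀ x y z : (Σ _ : Fin p, Fin m × Fin m),
        matMulDirectSum ℂ (fun _ : Fin p => m) (fun _ : Fin p => m) (fun _ : Fin p => m) x y z =
          (if β y + γ z = α x ∧ (β y, γ z) ∈ P then (1 : ℂ) else 0)) ∧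
      (∃ wa wb wc : G → ℤ, ∀ u v : G,
        0 ≤ wa (u + v) + wb u + wc v ∧ (wa (u + v) + wb u + wc v = 0 ↔ (u, v) ∈ P)) ∧
      (Fintype.card G : ℝ) ≤ (p : ℝ) * (m : ℝ) ^ (2 + η) := by
  sorry

/-- STUB 2 — LEVEL-SET COMPLETIONS OF POWERS (provable now, size M/L).  Given a toric weight triple for
`(G, P)`, for every `N` the indicator `S_N(a;b,c) = [Σ_t w_a(a_t) + Σ_t w_b(b_t) + Σ_t w_c(c_t) = 0]`
satisfies `T_P^{⊗N} = U_G^{⊗N} ∘ S_N` entrywise (on the addition graph the sum is a sum of `N`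
non-negative cell weights, zero iff every coordinate cell is kept) and
`R(S_N) ≤ |range W_a| · |range W_b| ≤ C · (N+1)²` with `C = (h_a + 1)(h_b + 1)`, `h` the weight ranges
(write `S_N = Σ_{i,j} 1_{W_a = i} ⊗ 1_{W_b = j} ⊗ 1_{W_c = −i−j}`, `tensorRank_le_card_of_eq_sum`). -/
theorem stub_weightCompletion :
    ∀ (G : Type) [AddCommGroup G] [Fintype G] [DecidableEq G] (P : Finset (G × G))
      (wa wb wc : G → ℤ),
      (∀ u v : G, 0 ≤ wa (u + v) + wb u + wc v ∧ (wa (u + v) + wb u + wc v = 0 ↔ (u, v) ∈ P)) →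
      ∃ C : ℝ, ∀ N : ℕ, ∃ S : (Fin N → G) → (Fin N → G) → (Fin N → G) → ℂ,
        (∀ a b c : Fin N → G,
          kroneckerPow (fun a b c : G => if b + c = a ∧ (b, c) ∈ P then (1 : ℂ) else 0) N a b c =
            kroneckerPow (fun a b c : G => if b + c = a then (1 : ℂ) else 0) N a b c * S a b c) ∧
        (tensorRank S : ℝ) ≤ C * ((N : ℝ) + 1) ^ 2 := by
  sorry

/-- COMPOSITION (real proof): toric packing at `η/2` + level-set completions + "exponential beats
polynomial" (`AutomaticPackingThesis.stub_expBeatsPoly`, a landed tree lemma) give the data of X with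
cost `|G|^N · R(S_N) ≤ (p m^{2+η/2})^N · (m^{η/2})^N = (p · m^{2+η})^N`. -/
theorem GrowingHostDesigns_of
    (hT : ∀ η : ℝ, 0 < η → ∃ (G : Type) (_ : AddCommGroup G) (_ : Fintype G) (_ : DecidableEq G)
      (P : Finset (G × G)) (p m : ℕ), 1 ≤ p ∧ 2 ≤ m ∧
      (∃ α β γ : (Σ _ : Fin p, Fin m × Fin m) → G, ∀ x y z : (Σ _ : Fin p, Fin m × Fin m),
      matMulDirectSum ℂ (fun _ : Fin p => m) (fun _ : Fin p => m) (fun _ : Fin p => m) x y z =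
      (if β y + γ z = α x ∧ (β y, γ z) ∈ P then (1 : ℂ) else 0)) ∧
      (∃ wa wb wc : G → ℤ, ∀ u v : G,
      0 ≤ wa (u + v) + wb u + wc v ∧ (wa (u + v) + wb u + wc v = 0 ↔ (u, v) ∈ P)) ∧
      (Fintype.card G : ℝ) ≤ (p : ℝ) * (m : ℝ) ^ (2 + η))
    (hW : ∀ (G : Type) [AddCommGroup G] [Fintype G] [DecidableEq G] (P : Finset (G × G))
      (wa wb wc : G → ℤ),
      (∀ u v : G, 0 ≤ wa (u + v) + wb u + wc v ∧ (wa (u + v) + wb u + wc v = 0 ↔ (u, v) ∈ P)) →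
      ∃ C : ℝ, ∀ N : ℕ, ∃ S : (Fin N → G) → (Fin N → G) → (Fin N → G) → ℂ,
      (∀ a b c : Fin N → G,
      kroneckerPow (fun a b c : G => if b + c = a ∧ (b, c) ∈ P then (1 : ℂ) else 0) N a b c =
      kroneckerPow (fun a b c : G => if b + c = a then (1 : ℂ) else 0) N a b c * S a b c) ∧
      (tensorRank S : ℝ) ≤ C * ((N : ℝ) + 1) ^ 2) :
    GrowingHostDesignsVia := by
  show GrowingHostDesigns
  intro η hη
  obtain ⟨G, iG, iF, iD, P, p, m, hp, hm, hhost, ⟨wa, wb, wc, hw⟩, hcard⟩ := hT (η / 2) (by positivity)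
  obtain ⟨C, hC⟩ := hW G P wa wb wc hw
  have hm1 : (1 : ℝ) < (m : ℝ) := by
    have h : 1 < m := hm
    exact_mod_cast h
  have hm0 : (0 : ℝ) < (m : ℝ) := zero_lt_one.trans hm1
  have hr : (1 : ℝ) < (m : ℝ) ^ (η / 2) := Real.one_lt_rpow hm1 (by positivity)
  obtain ⟨M₀, hM₀⟩ :=
    Summit.MatrixMultiplication.MatrixMultiplication.Theorems.AutomaticPackingThesis.stub_expBeatsPoly
      ((m : ℝ) ^ (η / 2)) hr 2 (4 * |C|)
  obtain ⟨S, hS, hRS⟩ := hC (M₀ + 1)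
  refine ⟨G, iG, iF, iD, P, p, m, M₀ + 1, hp, hm, Nat.le_add_left 1 M₀, hhost, S, hS, ?_⟩
  -- `C · (N+1)² ≤ (m^{η/2})^N` at `N = M₀ + 1`
  have hCN : C * (((M₀ + 1 : ℕ) : ℝ) + 1) ^ 2 ≤ ((m : ℝ) ^ (η / 2)) ^ (M₀ + 1) := by
    have hM : (0 : ℝ) ≤ (M₀ : ℝ) := Nat.cast_nonneg _
    have h1 : C * (((M₀ + 1 : ℕ) : ℝ) + 1) ^ 2 ≤ |C| * (((M₀ + 1 : ℕ) : ℝ) + 1) ^ 2 :=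
      mul_le_mul_of_nonneg_right (le_abs_self C) (by positivity)
    have h2 : (((M₀ + 1 : ℕ) : ℝ) + 1) ^ 2 ≤ 4 * ((M₀ : ℝ) + 1) ^ 2 := by
      push_cast
      nlinarith
    have h3 : |C| * (((M₀ + 1 : ℕ) : ℝ) + 1) ^ 2 ≤ (4 * |C|) * ((M₀ : ℝ) + 1) ^ 2 := by
      nlinarith [abs_nonneg C]
    have h5 : ((m : ℝ) ^ (η / 2)) ^ M₀ ≤ ((m : ℝ) ^ (η / 2)) ^ (M₀ + 1) :=
      pow_le_pow_right₀ hr.le (Nat.le_succ M₀)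
    linarith
  have hRS' : (tensorRank S : ℝ) ≤ ((m : ℝ) ^ (η / 2)) ^ (M₀ + 1) := hRS.trans hCN
  have hG0 : (0 : ℝ) ≤ (Fintype.card G : ℝ) := Nat.cast_nonneg _
  calc (Fintype.card G : ℝ) ^ (M₀ + 1) * (tensorRank S : ℝ)
      ≤ ((p : ℝ) * (m : ℝ) ^ (2 + η / 2)) ^ (M₀ + 1) * ((m : ℝ) ^ (η / 2)) ^ (M₀ + 1) :=
        mul_le_mul (pow_le_pow_left₀ hG0 hcard (M₀ + 1)) hRS' (Nat.cast_nonneg _) (by positivity)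
    _ = ((p : ℝ) * (m : ℝ) ^ (2 + η)) ^ (M₀ + 1) := by
        rw [← mul_pow]
        congr 1
        rw [mul_assoc, ← Real.rpow_add hm0]
        ring_nf

/-- THE SKELETON THEOREM: the crux BY NAME from the two registered stubs (sorry-dependence only through
`stub_toricPacking`, `stub_weightCompletion`; the composition `GrowingHostDesigns_of` has no `sorry` of its own). -/
theorem GrowingHostDesigns_of_stubs : GrowingHostDesigns :=
  GrowingHostDesigns_of stub_toricPacking stub_weightCompletion

end Summit.MatrixMultiplication.MatrixMultiplication.Cruxes.GrowingHostDesigns.ToricPunctures
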